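import Literature.MathematicalPhysics.QuantumFieldTheory.Balaban1983to89.HaarExponentialChartGlobal

/-!
# `Balaban1983to89.HaarExpChartChangeOfVariables` — the CHANGE OF VARIABLES FOR HAAR MEASURE under maps that are `C¹` in
# exponential coordinates, on every compact group faithfully represented on a log-charted linear group: [Helgason2000]
# Ch. I §1 Thm. 1.14 (13) on an injectivity domain (p28 `HaarExponentialChartGlobal`) COMPOSED with the `ℝⁿ` change of
# variables (Mathlib `lintegral_image_eq_lintegral_abs_det_fderiv_mul`), and its GROUP-LEVEL (Haar-to-Haar, `σ₀`-free) form

statement-level skeleton of published theorems with citation tags; proofs where landed; nothing here is a claim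
about the Yang–Mills mass gap

Cell `pub-ymgap`, seat `pub-ymgap-dag-n09-w4` (gen 4; node N09 = [Balaban1987RG1] §§2–5, helper lane of the K1⁷ item,
count-neutral).  WHY THIS FILE: the Jacobian face (F1) of Bałaban's block-averaging transform — print's δ-function calculus
[Balaban1987RG1] (2.10) p. 267 *«∫dV δ(V̄W⁻¹) χ_k exp[…] = ∫dB′ σ(B′) δ(Q̃(B′)) χ_k exp[…]»* followed by the substitution
*«B′ = B − hD̃(B)»* — needs, at measure level, the change of variables for Haar measure under a map of the group that is
differentiable IN THE CHART.  Mathlib's change of variables is `ℝⁿ`-only; the tree has Haar measure in exponential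
coordinates on an arbitrary injectivity domain (`lintegral_haar_image_eq`: `∫_{Θ(Ω)} F dμ = σ₀ ∫_Ω F(Θ X)|det jac X| dη`,
[Helgason2000] (13), [Balaban1985UV3] p. 260 «dU′ = σ(A′)dA′ = σ₀ (σ/σ₀)(A′)dA′»).  This file composes the two.

SETTING = p28's (`HaarExponentialChart{,Density,Cocycle,Measure,Global}`): `h : IsChartRep C ρ` (every closed `G ≤ U(N)`),
`𝔤 = C.lie` finite-dimensional, `ad`-stable (`hlie`), `Θ = h.expChart`, `Λ = h.logChart`, `η` additive Haar on `𝔤`, `μ` Haar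
on `G`, `σ₀ = μ(V_s)/ν_s(V_s)` (`0 < s ≤ s_C = chartRadius C`), `jacDensity X = |det jac X|`.

CONTENT (theorems only; 0 def, 0 instance, 0 sorry; axioms standard).
* §1 `lintegral_chartMeasureOn_of_injOn`, **`lintegral_haar_image_eq_of_injOn`** — p28's (13)-on-`Ω` for EVERY
  `F : G → ℝ≥0∞` (no measurability hypothesis) once `Θ` is injective on the Borel set `Ω` (the restriction `Ω.restrict Θ`
  is then a measurable embedding: Lusin–Souslin, Mathlib `ContinuousOn.measurableEmbedding`).
* §2 THE SUBSTITUTION INSIDE THE CHART: for a Borel `Ω ⊆ 𝔤`, `ψ : 𝔤 → 𝔤` injective on `Ω` with a derivative `ψ′` within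
  `Ω`, and `Θ` injective on `ψ(Ω)`:
  **`lintegral_haar_image_image_eq`: `∫_{Θ(ψ Ω)} F dμ = σ₀ ∫_Ω F(Θ(ψ X)) · |det jac(ψ X)| · |det ψ′(X)| dη(X)`** for every
  `F ≥ 0`; `haar_image_image_eq` (`F = 1`).  This is the form print's (2.10) route uses (the substitution `B′ = B − hD̃(B)`
  INSIDE the chart, Haar read through `σ/σ₀ = |det jac|`).
* §3 THE GROUP-LEVEL JACOBIAN (`σ₀`- and `η`-free): for `Ψ : G → G` with `Ψ(Θ X) = Θ(ψ X)` on `Ω ⊆ B(0,s)`, `ψ(Ω) ⊆ B(0,s)`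
  and `det jac ≠ 0` on `Ω`:
  **`lintegral_haar_image_eq_lintegral_mul_jacobian`:
  `∫_{Ψ(Θ Ω)} F dμ = ∫_{Θ Ω} F(Ψ g) · (|det jac(ψ(Λg))| · |det ψ′(Λg)| / |det jac(Λg)|) dμ(g)`** for every `F ≥ 0` —
  Haar to Haar with the Jacobian written out (no `def`); `lintegral_haar_image_eq_mul_of_semiconj` (the same in
  coordinates); `exists_radius_det_jac_ne_zero` (p28's `exists_ball_det_jac_pos` packaged: the hypothesis `det jac ≠ 0`
  holds on every `Ω ⊆ B(0, s₀)`); `continuousOn_jacobian` (the Jacobian is continuous on `Ω` when `ψ`, `ψ′` are).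
* §4 `aemeasurable_restrict_image_of_comp_expChart` (a.e.-measurability transported through the chart),
  `aemeasurable_jacobian`, **`haar_restrict_image_eq_map_withDensity_jacobian`: `μ|_{Ψ(ΘΩ)} = Ψ_*(J_Ψ · μ|_{ΘΩ})`** (the
  measure form) and **`setIntegral_haar_image_eq_integral_jacobian_smul`** (the Bochner form, Banach-valued integrands).

HONEST SCOPE.  (i) Standard («folklore») measure theory: nothing of Bałaban's is asserted or estimated; the file constructs NO chart
of Bałaban's — the (2.10) linearising map `D̃_W` at the record, the one-variable fibre maps of the tree's private-coordinate
route (`BlockAveragingHaarAC`) and their injectivity ∕ derivatives stay hypotheses (`ψ`, `ψ′`, `InjOn`, the semiconjugacy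
`Ψ ∘ Θ = Θ ∘ ψ`) wherever used.  (ii) The window constant `σ₀` is p28's, identified not evaluated (`windowConst_eq_div`).
(iii) Nothing of p28 ∕ p24 ∕ r10 ∕ Mathlib is re-proved.  (iv) §3–§4 ask `Ω, ψ(Ω) ⊆ B(0,s)`, `s ≤ s_C` (so `Λ ∘ Θ = id`
there); larger injectivity domains are served by §2.
-/

noncomputable section

open NormedSpace Set Function Filter Topology MeasureTheory
open scoped ENNReal NNReal

namespace Literature.MathematicalPhysics.QuantumFieldTheory.Balaban1983to89.HaarExponentialChart

namespace IsChartRep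

open B13HaarSigmaJacobian (jac)

/-! ## §1 (13) on an injectivity domain for EVERY integrand (no measurability hypothesis) -/

section AllIntegrands

variable {𝔸 : Type*} [NormedRing 𝔸] [NormedAlgebra ℂ 𝔸] [CompleteSpace 𝔸]
variable {G : Type*} [Group G] [TopologicalSpace G] [IsTopologicalGroup G] [CompactSpace G]
variable {C : LogChart 𝔸} {ρ : G →* 𝔸} (h : IsChartRep C ρ) [FiniteDimensional ℝ C.lie]
  (hlie : ∀ x ∈ C.lie, ∀ y ∈ C.lie, x * y - y * x ∈ C.lie)
variable [MeasurableSpace C.lie] [BorelSpace C.lie] (η : Measure C.lie)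
variable [MeasurableSpace G] [BorelSpace G]

omit [IsTopologicalGroup G] in
/-- Structure of the chart measure: `ν_Ω = (Θ|_Ω)_*(ι_Ω^*(|det jac| dη))` — the push-forward under the RESTRICTED chart
`Ω.restrict Θ : Ω → G` of the pull-back of `|det jac| dη` to the subtype `Ω`. [cite: Helgason2000, Ch. I §1 Thm. 1.14 (13) p. 96] -/
theorem chartMeasureOn_eq_map_restrict {Ω : Set C.lie} (hΩ : MeasurableSet Ω) :
    h.chartMeasureOn hlie η Ω =
      Measure.map (Ω.restrict h.expChart) (Measure.comap ((↑) : Ω → C.lie) (η.withDensity (jacDensity hlie))) := by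
  rw [chartMeasureOn, ← restrict_withDensity hΩ, ← map_comap_subtype_coe hΩ,
    Measure.map_map h.measurable_expChart measurable_subtype_coe]
  rfl

omit [IsTopologicalGroup G] in
/-- **`∫ F dν_Ω = ∫_Ω F(Θ X) |det jac X| dη(X)` for EVERY `F : G → ℝ≥0∞`** once `Θ` is injective on the Borel set `Ω`
(then `Ω.restrict Θ` is a measurable embedding — Lusin–Souslin — and no measurability of `F` is needed; p28's
`lintegral_chartMeasureOn` asks `F` measurable and no injectivity). [cite: Helgason2000, Ch. I §1 Thm. 1.14 (13) p. 96] -/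
theorem lintegral_chartMeasureOn_of_injOn {Ω : Set C.lie} (hΩ : MeasurableSet Ω) (hinj : Set.InjOn h.expChart Ω)
    (F : G → ℝ≥0∞) :
    ∫⁻ g, F g ∂(h.chartMeasureOn hlie η Ω) = ∫⁻ X in Ω, F (h.expChart X) * jacDensity hlie X ∂η := by
  haveI : T2Space G := h.isClosedEmbedding.isEmbedding.t2Space
  have hemb : MeasurableEmbedding (Ω.restrict h.expChart) :=
    h.continuous_expChart.continuousOn.measurableEmbedding hΩ hinj
  rw [h.chartMeasureOn_eq_map_restrict hlie η hΩ, hemb.lintegral_map]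
  have h2 : (fun x : Ω => F (Ω.restrict h.expChart x)) = fun x : Ω => (F ∘ h.expChart) (x : C.lie) := rfl
  rw [h2, ← (MeasurableEmbedding.subtype_coe hΩ).lintegral_map (F ∘ h.expChart), map_comap_subtype_coe hΩ,
    setLIntegral_withDensity_eq_setLIntegral_mul_non_measurable _ (measurable_jacDensity hlie) _ hΩ
      (Eventually.of_forall fun X => by rw [jacDensity_def]; exact ENNReal.ofReal_lt_top)]
  exact lintegral_congr fun X => mul_comm _ _

variable [η.IsAddHaarMeasure] (μ : Measure G) [μ.IsHaarMeasure]

/-- **(13) ON `Θ(Ω)` FOR EVERY INTEGRAND: `∫_{Θ(Ω)} F dμ = σ₀ · ∫_Ω F(Θ X) |det jac X| dη(X)`** for every `F : G → ℝ≥0∞`,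
every Borel injectivity domain `Ω`, `σ₀ = μ(V_s)/ν_s(V_s)` (p28's `lintegral_haar_image_eq` without the measurability of `F`).
[cite: Helgason2000, Ch. I §1 Thm. 1.14 (13) p. 96] [cite: Balaban1985UV3, p. 260] -/
theorem lintegral_haar_image_eq_of_injOn {s : ℝ} (hs0 : 0 < s) (hs : s ≤ chartRadius C) {Ω : Set C.lie}
    (hΩ : MeasurableSet Ω) (hinj : Set.InjOn h.expChart Ω) (F : G → ℝ≥0∞) :
    ∫⁻ g in h.expChart '' Ω, F g ∂μ =
      (μ (h.window s) / h.chartMeasure hlie η s (h.window s)) * ∫⁻ X in Ω, F (h.expChart X) * jacDensity hlie X ∂η := by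
  rw [h.haar_restrict_image_eq_smul_chartMeasureOn hlie η μ hs0 hs hΩ hinj, lintegral_smul_measure,
    h.lintegral_chartMeasureOn_of_injOn hlie η hΩ hinj F, smul_eq_mul]

end AllIntegrands

/-! ## §2 The substitution INSIDE the chart: `∫_{Θ(ψ Ω)} F dμ = σ₀ ∫_Ω F(Θ(ψ X)) |det jac(ψ X)| |det ψ′(X)| dη` -/

section ChartSide

variable {𝔸 : Type*} [NormedRing 𝔸] [NormedAlgebra ℂ 𝔸] [CompleteSpace 𝔸]
variable {G : Type*} [Group G] [TopologicalSpace G] [IsTopologicalGroup G] [CompactSpace G]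
variable {C : LogChart 𝔸} {ρ : G →* 𝔸} (h : IsChartRep C ρ) [FiniteDimensional ℝ C.lie]
  (hlie : ∀ x ∈ C.lie, ∀ y ∈ C.lie, x * y - y * x ∈ C.lie)
variable [MeasurableSpace C.lie] [BorelSpace C.lie] (η : Measure C.lie) [η.IsAddHaarMeasure]
variable [MeasurableSpace G] [BorelSpace G] (μ : Measure G) [μ.IsHaarMeasure]

/-- **HAAR MEASURE UNDER A SUBSTITUTION INSIDE THE EXPONENTIAL CHART.**  For `0 < s ≤ s_C`, a Borel `Ω ⊆ 𝔤`, a map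
`ψ : 𝔤 → 𝔤` injective on `Ω` with derivative `ψ′(X)` within `Ω` at every `X ∈ Ω`, and `Θ` injective on `ψ(Ω)`:
`∫_{Θ(ψ Ω)} F dμ = σ₀ · ∫_Ω F(Θ(ψ X)) · |det jac(ψ X)| · |det ψ′(X)| dη(X)` for every `F : G → ℝ≥0∞` — (13) on the
injectivity domain `ψ(Ω)` composed with the `ℝⁿ` change of variables `X ↦ ψ X` (print: «dU′ = σ₀ (σ/σ₀)(A′)dA′» and then a
substitution in the variables `A′`, e.g. [Balaban1987RG1] p. 267 «B′ = B − hD̃(B)»).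
[cite: Helgason2000, Ch. I §1 Thm. 1.14 (13) p. 96] [cite: Balaban1985UV3, p. 260] -/
theorem lintegral_haar_image_image_eq {s : ℝ} (hs0 : 0 < s) (hs : s ≤ chartRadius C) {Ω : Set C.lie}
    (hΩ : MeasurableSet Ω) {ψ : C.lie → C.lie} {ψ' : C.lie → C.lie →L[ℝ] C.lie}
    (hψ' : ∀ X ∈ Ω, HasFDerivWithinAt ψ (ψ' X) Ω X) (hψ : Set.InjOn ψ Ω) (hinj : Set.InjOn h.expChart (ψ '' Ω))
    (F : G → ℝ≥0∞) :
    ∫⁻ g in h.expChart '' (ψ '' Ω), F g ∂μ =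
      (μ (h.window s) / h.chartMeasure hlie η s (h.window s)) *
        ∫⁻ X in Ω, F (h.expChart (ψ X)) * jacDensity hlie (ψ X) * ENNReal.ofReal |(ψ' X).det| ∂η := by
  have hψΩ : MeasurableSet (ψ '' Ω) := measurable_image_of_fderivWithin hΩ hψ' hψ
  rw [h.lintegral_haar_image_eq_of_injOn hlie η μ hs0 hs hψΩ hinj F,
    lintegral_image_eq_lintegral_abs_det_fderiv_mul η hΩ hψ' hψ]
  congr 1
  exact lintegral_congr fun X => by ring

/-- `μ(Θ(ψ Ω)) = σ₀ · ∫_Ω |det jac(ψ X)| · |det ψ′(X)| dη(X)` (the case `F = 1`).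
[cite: Helgason2000, Ch. I §1 Thm. 1.14 (13) p. 96] -/
theorem haar_image_image_eq {s : ℝ} (hs0 : 0 < s) (hs : s ≤ chartRadius C) {Ω : Set C.lie}
    (hΩ : MeasurableSet Ω) {ψ : C.lie → C.lie} {ψ' : C.lie → C.lie →L[ℝ] C.lie}
    (hψ' : ∀ X ∈ Ω, HasFDerivWithinAt ψ (ψ' X) Ω X) (hψ : Set.InjOn ψ Ω) (hinj : Set.InjOn h.expChart (ψ '' Ω)) :
    μ (h.expChart '' (ψ '' Ω)) =
      (μ (h.window s) / h.chartMeasure hlie η s (h.window s)) *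
        ∫⁻ X in Ω, jacDensity hlie (ψ X) * ENNReal.ofReal |(ψ' X).det| ∂η := by
  have := h.lintegral_haar_image_image_eq hlie η μ hs0 hs hΩ hψ' hψ hinj (fun _ => 1)
  simp only [one_mul, lintegral_one, Measure.restrict_apply MeasurableSet.univ, Set.univ_inter] at this
  exact this

/-- The same with the window hypotheses spelled out: if `ψ(Ω) ⊆ B(0, s)` then `Θ` is injective on `ψ(Ω)` automatically
(`injOn_expChart`). [cite: Helgason2000, Ch. I §1 Thm. 1.14 (13) p. 96] -/
theorem lintegral_haar_image_image_eq_of_mapsTo {s : ℝ} (hs0 : 0 < s) (hs : s ≤ chartRadius C) {Ω : Set C.lie}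
    (hΩ : MeasurableSet Ω) {ψ : C.lie → C.lie} {ψ' : C.lie → C.lie →L[ℝ] C.lie}
    (hψ' : ∀ X ∈ Ω, HasFDerivWithinAt ψ (ψ' X) Ω X) (hψ : Set.InjOn ψ Ω)
    (hψs : Set.MapsTo ψ Ω (Metric.ball (0 : C.lie) s)) (F : G → ℝ≥0∞) :
    ∫⁻ g in h.expChart '' (ψ '' Ω), F g ∂μ =
      (μ (h.window s) / h.chartMeasure hlie η s (h.window s)) *
        ∫⁻ X in Ω, F (h.expChart (ψ X)) * jacDensity hlie (ψ X) * ENNReal.ofReal |(ψ' X).det| ∂η :=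
  h.lintegral_haar_image_image_eq hlie η μ hs0 hs hΩ hψ' hψ ((h.injOn_expChart hs).mono hψs.image_subset) F

/-! ## §3 The group-level Jacobian: `∫_{Ψ(Θ Ω)} F dμ = ∫_{Θ Ω} F(Ψ g) · J_Ψ(g) dμ(g)` (Haar to Haar, `σ₀`-free) -/

omit [CompleteSpace 𝔸] [IsTopologicalGroup G] [CompactSpace G] [FiniteDimensional ℝ C.lie] [MeasurableSpace C.lie]
  [BorelSpace C.lie] [MeasurableSpace G] [BorelSpace G] in
/-- Bookkeeping: a map `Ψ` of the group that reads `ψ` in the chart on `Ω` (`Ψ(Θ X) = Θ(ψ X)`) sends `Θ(Ω)` onto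
`Θ(ψ Ω)`. [cite: Helgason2000, Ch. I §1 Thm. 1.14 (13) p. 96 (bookkeeping)] -/
theorem image_image_expChart_of_semiconj {Ω : Set C.lie} {ψ : C.lie → C.lie} {Ψ : G → G}
    (hΨ : ∀ X ∈ Ω, Ψ (h.expChart X) = h.expChart (ψ X)) : Ψ '' (h.expChart '' Ω) = h.expChart '' (ψ '' Ω) := by
  rw [Set.image_image, Set.image_image]; exact Set.image_congr fun X hX => hΨ X hX

/-- **THE IMAGE OF `Θ(Ω)` UNDER A CHART-DIFFERENTIABLE MAP, IN COORDINATES.**  For `0 < s ≤ s_C`, a Borel `Ω ⊆ 𝔤`,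
`ψ` injective and differentiable within `Ω` with `ψ(Ω) ⊆ B(0,s)`, and `Ψ : G → G` with `Ψ(Θ X) = Θ(ψ X)` on `Ω`:
`∫_{Ψ(Θ Ω)} F dμ = σ₀ · ∫_Ω F(Ψ(Θ X)) · |det jac(ψ X)| · |det ψ′(X)| dη(X)` for every `F : G → ℝ≥0∞`.
[cite: Helgason2000, Ch. I §1 Thm. 1.14 (13) p. 96] -/
theorem lintegral_haar_image_eq_mul_of_semiconj {s : ℝ} (hs0 : 0 < s) (hs : s ≤ chartRadius C) {Ω : Set C.lie}
    (hΩ : MeasurableSet Ω) {ψ : C.lie → C.lie} {ψ' : C.lie → C.lie →L[ℝ] C.lie}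
    (hψ' : ∀ X ∈ Ω, HasFDerivWithinAt ψ (ψ' X) Ω X) (hψ : Set.InjOn ψ Ω)
    (hψs : Set.MapsTo ψ Ω (Metric.ball (0 : C.lie) s)) {Ψ : G → G}
    (hΨ : ∀ X ∈ Ω, Ψ (h.expChart X) = h.expChart (ψ X)) (F : G → ℝ≥0∞) :
    ∫⁻ g in Ψ '' (h.expChart '' Ω), F g ∂μ =
      (μ (h.window s) / h.chartMeasure hlie η s (h.window s)) *
        ∫⁻ X in Ω, F (Ψ (h.expChart X)) * jacDensity hlie (ψ X) * ENNReal.ofReal |(ψ' X).det| ∂η := by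
  rw [h.image_image_expChart_of_semiconj hΨ, h.lintegral_haar_image_image_eq_of_mapsTo hlie η μ hs0 hs hΩ hψ' hψ hψs F]
  congr 1
  exact setLIntegral_congr_fun hΩ fun X hX => by rw [hΨ X hX]

/-- **THE GROUP-LEVEL HAAR JACOBIAN OF A CHART-DIFFERENTIABLE MAP.**  For `0 < s ≤ s_C`, a Borel `Ω ⊆ B(0,s)` on which
`det jac ≠ 0`, `ψ` injective and differentiable within `Ω` with `ψ(Ω) ⊆ B(0,s)`, and `Ψ : G → G` with `Ψ(Θ X) = Θ(ψ X)`
on `Ω`:  **`∫_{Ψ(Θ Ω)} F dμ = ∫_{Θ Ω} F(Ψ g) · J_Ψ(g) dμ(g)`** for every `F : G → ℝ≥0∞`, with the Jacobian WITH RESPECT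
TO HAAR MEASURE written out: `J_Ψ(g) = |det jac(ψ(Λ g))| · |det ψ′(Λ g)| / |det jac(Λ g)|` (`Λ` the log chart; on `Θ(Ω)`,
`Λ(Θ X) = X`).  No window constant, no Lebesgue measure on `𝔤` in the statement: Haar to Haar.  This is the identity the
fibre∕coarea bookkeeping of a block-averaging transform consumes for each one-variable fibre map ([Balaban1987RG1] (2.10)
p. 267 «∫dV δ(V̄W⁻¹)… = ∫dB′ σ(B′) δ(Q̃(B′))…», read without δ-functions).
[cite: Helgason2000, Ch. I §1 Thm. 1.14 (13) p. 96] [cite: Balaban1987RG1, (2.10) p. 267] -/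
theorem lintegral_haar_image_eq_lintegral_mul_jacobian {s : ℝ} (hs0 : 0 < s) (hs : s ≤ chartRadius C)
    {Ω : Set C.lie} (hΩ : MeasurableSet Ω) (hΩs : Ω ⊆ Metric.ball (0 : C.lie) s)
    (hjac : ∀ X ∈ Ω, LinearMap.det (jac hlie X : C.lie →ₗ[ℝ] C.lie) ≠ 0)
    {ψ : C.lie → C.lie} {ψ' : C.lie → C.lie →L[ℝ] C.lie}
    (hψ' : ∀ X ∈ Ω, HasFDerivWithinAt ψ (ψ' X) Ω X) (hψ : Set.InjOn ψ Ω)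
    (hψs : Set.MapsTo ψ Ω (Metric.ball (0 : C.lie) s)) {Ψ : G → G}
    (hΨ : ∀ X ∈ Ω, Ψ (h.expChart X) = h.expChart (ψ X)) (F : G → ℝ≥0∞) :
    ∫⁻ g in Ψ '' (h.expChart '' Ω), F g ∂μ =
      ∫⁻ g in h.expChart '' Ω, F (Ψ g) *
        (jacDensity hlie (ψ (h.logChart g)) * ENNReal.ofReal |(ψ' (h.logChart g)).det| /
          jacDensity hlie (h.logChart g)) ∂μ := by
  -- any additive Haar measure on `𝔤` serves as the (invisible) reference measure
  let η : Measure C.lie := (Module.finBasis ℝ C.lie).addHaar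
  have hinjΩ : Set.InjOn h.expChart Ω := (h.injOn_expChart hs).mono hΩs
  rw [h.lintegral_haar_image_eq_mul_of_semiconj hlie η μ hs0 hs hΩ hψ' hψ hψs hΨ F,
    h.lintegral_haar_image_eq_of_injOn hlie η μ hs0 hs hΩ hinjΩ]
  congr 1
  refine setLIntegral_congr_fun hΩ fun X hX => ?_
  have hXs : ‖X‖ < chartRadius C := lt_of_lt_of_le (mem_ball_zero_iff.1 (hΩs hX)) hs
  have hΛ : h.logChart (h.expChart X) = X := h.logChart_expChart hXs
  have hj0 : jacDensity hlie X ≠ 0 := by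
    rw [jacDensity_def]; exact fun h0 => hjac X hX (abs_eq_zero.1 (ENNReal.ofReal_eq_zero.1 h0 |>.antisymm (abs_nonneg _)))
  have hjtop : jacDensity hlie X ≠ ∞ := by rw [jacDensity_def]; exact ENNReal.ofReal_ne_top
  rw [hΛ]
  symm
  rw [mul_assoc, ENNReal.div_mul_cancel hj0 hjtop, mul_assoc]

omit [CompleteSpace 𝔸] [MeasurableSpace C.lie] [BorelSpace C.lie] in
/-- **THE NON-DEGENERACY RADIUS**: there is `s₀ > 0` (p28's `exists_ball_det_jac_pos`) such that the hypothesis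
`det jac ≠ 0 on Ω` of `lintegral_haar_image_eq_lintegral_mul_jacobian` holds for every `Ω ⊆ B(0, s₀)`.
[cite: Balaban1985UV3, p. 260] [cite: Helgason2000, Ch. I §1 Thm. 1.14 (12) p. 96] -/
theorem exists_radius_det_jac_ne_zero :
    ∃ s₀ : ℝ, 0 < s₀ ∧ ∀ Ω : Set C.lie, Ω ⊆ Metric.ball (0 : C.lie) s₀ →
      ∀ X ∈ Ω, LinearMap.det (jac hlie X : C.lie →ₗ[ℝ] C.lie) ≠ 0 := by
  obtain ⟨s₀, hs₀, hpos⟩ := exists_ball_det_jac_pos hlie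
  exact ⟨s₀, hs₀, fun Ω hΩ X hX => (hpos X (mem_ball_zero_iff.1 (hΩ hX))).ne'⟩

omit [CompleteSpace 𝔸] [MeasurableSpace C.lie] [BorelSpace C.lie] in
/-- **THE JACOBIAN IS CONTINUOUS** on `Θ(Ω)`-coordinates: if `ψ` is continuous on `Ω` and `ψ′` is continuous on `Ω`, then
`X ↦ |det jac(ψ X)| · |det ψ′(X)| / |det jac X|` (the Haar Jacobian of §3 read at `g = Θ X`) is continuous on `Ω` wherever
`det jac ≠ 0` — the «jointly continuous Jacobian» clause of the fibre bookkeeping, for the real-valued density.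
[cite: Helgason2000, Ch. I §1 Thm. 1.14 (12) p. 96] -/
theorem continuousOn_jacobian {Ω : Set C.lie}
    (hjac : ∀ X ∈ Ω, LinearMap.det (jac hlie X : C.lie →ₗ[ℝ] C.lie) ≠ 0)
    {ψ : C.lie → C.lie} {ψ' : C.lie → C.lie →L[ℝ] C.lie} (hψc : ContinuousOn ψ Ω) (hψ'c : ContinuousOn ψ' Ω) :
    ContinuousOn (fun X => |LinearMap.det (jac hlie (ψ X) : C.lie →ₗ[ℝ] C.lie)| * |(ψ' X).det| /
      |LinearMap.det (jac hlie X : C.lie →ₗ[ℝ] C.lie)|) Ω := by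
  have h1 : ContinuousOn (fun X => |LinearMap.det (jac hlie (ψ X) : C.lie →ₗ[ℝ] C.lie)|) Ω :=
    (continuous_abs.comp (continuous_det_jac hlie)).comp_continuousOn hψc
  have h2 : ContinuousOn (fun X => |(ψ' X).det|) Ω :=
    continuous_abs.comp_continuousOn (ContinuousLinearMap.continuous_det.comp_continuousOn hψ'c)
  have h3 : ContinuousOn (fun X => |LinearMap.det (jac hlie X : C.lie →ₗ[ℝ] C.lie)|) Ω :=
    (continuous_abs.comp (continuous_det_jac hlie)).continuousOn
  exact (h1.mul h2).div h3 fun X hX => abs_ne_zero.2 (hjac X hX)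

/-! ## §4 The measure form and the Bochner form of the group-level Jacobian -/

include hlie in
/-- **TRANSPORT OF a.e.-MEASURABILITY THROUGH THE CHART**: a function on `G` whose chart reading `g ∘ Θ` is
`η|_Ω`-a.e.-measurable is `μ|_{Θ(Ω)}`-a.e.-measurable (`0 < s ≤ s_C`, `Θ` injective on the Borel set `Ω`) — through
`μ|_{Θ(Ω)} = σ₀ • ν_Ω`, the measurable embedding `Ω.restrict Θ` and `|det jac| dη ≪ dη`.
[cite: Helgason2000, Ch. I §1 Thm. 1.14 (13) p. 96] -/
theorem aemeasurable_restrict_image_of_comp_expChart {s : ℝ} (hs0 : 0 < s) (hs : s ≤ chartRadius C)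
    {Ω : Set C.lie} (hΩ : MeasurableSet Ω) (hinj : Set.InjOn h.expChart Ω)
    {β : Type*} [MeasurableSpace β] {g : G → β} (hg : AEMeasurable (g ∘ h.expChart) (η.restrict Ω)) :
    AEMeasurable g (μ.restrict (h.expChart '' Ω)) := by
  haveI : T2Space G := h.isClosedEmbedding.isEmbedding.t2Space
  have hemb : MeasurableEmbedding (Ω.restrict h.expChart) :=
    h.continuous_expChart.continuousOn.measurableEmbedding hΩ hinj
  rw [h.haar_restrict_image_eq_smul_chartMeasureOn hlie η μ hs0 hs hΩ hinj, h.chartMeasureOn_eq_map_restrict hlie η hΩ]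
  refine AEMeasurable.smul_measure ?_ _
  rw [hemb.aemeasurable_map_iff]
  have hcomp : g ∘ Ω.restrict h.expChart = (g ∘ h.expChart) ∘ ((↑) : Ω → C.lie) := rfl
  rw [hcomp, ← (MeasurableEmbedding.subtype_coe hΩ).aemeasurable_map_iff, map_comap_subtype_coe hΩ,
    restrict_withDensity hΩ]
  exact hg.mono_ac (withDensity_absolutelyContinuous _ _)

include hlie in
/-- A map `Ψ` of the group reading a map `ψ` continuous on `Ω` in the chart (`Ψ(Θ X) = Θ(ψ X)` on `Ω`) is
`μ|_{Θ(Ω)}`-a.e.-measurable. [cite: Helgason2000, Ch. I §1 Thm. 1.14 (13) p. 96] -/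
theorem aemeasurable_restrict_image_of_semiconj {s : ℝ} (hs0 : 0 < s) (hs : s ≤ chartRadius C)
    {Ω : Set C.lie} (hΩ : MeasurableSet Ω) (hinj : Set.InjOn h.expChart Ω) {ψ : C.lie → C.lie}
    (hψc : ContinuousOn ψ Ω) {Ψ : G → G} (hΨ : ∀ X ∈ Ω, Ψ (h.expChart X) = h.expChart (ψ X)) :
    AEMeasurable Ψ (μ.restrict (h.expChart '' Ω)) := by
  let η : Measure C.lie := (Module.finBasis ℝ C.lie).addHaar
  refine h.aemeasurable_restrict_image_of_comp_expChart hlie η μ hs0 hs hΩ hinj ?_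
  have h1 : AEMeasurable (h.expChart ∘ ψ) (η.restrict Ω) :=
    h.measurable_expChart.comp_aemeasurable (hψc.aemeasurable hΩ)
  exact h1.congr ((ae_restrict_mem hΩ).mono fun X hX => (hΨ X hX).symm)

/-- The group-level Jacobian `J_Ψ(g) = |det jac(ψ(Λ g))| · |det ψ′(Λ g)| / |det jac(Λ g)|` is `μ|_{Θ(Ω)}`-a.e.-measurable
(`Ω ⊆ B(0,s)`; the derivative family `ψ′` is a.e.-measurable on `Ω` by Mathlib's `aemeasurable_fderivWithin`).
[cite: Helgason2000, Ch. I §1 Thm. 1.14 (12)–(13) p. 96] -/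
theorem aemeasurable_jacobian {s : ℝ} (hs0 : 0 < s) (hs : s ≤ chartRadius C)
    {Ω : Set C.lie} (hΩ : MeasurableSet Ω) (hΩs : Ω ⊆ Metric.ball (0 : C.lie) s)
    {ψ : C.lie → C.lie} {ψ' : C.lie → C.lie →L[ℝ] C.lie} (hψ' : ∀ X ∈ Ω, HasFDerivWithinAt ψ (ψ' X) Ω X) :
    AEMeasurable (fun g => jacDensity hlie (ψ (h.logChart g)) * ENNReal.ofReal |(ψ' (h.logChart g)).det| /
      jacDensity hlie (h.logChart g)) (μ.restrict (h.expChart '' Ω)) := by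
  let η : Measure C.lie := (Module.finBasis ℝ C.lie).addHaar
  have hinjΩ : Set.InjOn h.expChart Ω := (h.injOn_expChart hs).mono hΩs
  refine h.aemeasurable_restrict_image_of_comp_expChart hlie η μ hs0 hs hΩ hinjΩ ?_
  have hψc : ContinuousOn ψ Ω := fun X hX => (hψ' X hX).continuousWithinAt
  have ha : AEMeasurable (fun X => jacDensity hlie (ψ X)) (η.restrict Ω) :=
    (measurable_jacDensity hlie).comp_aemeasurable (hψc.aemeasurable hΩ)
  have hb : AEMeasurable (fun X => ENNReal.ofReal |(ψ' X).det|) (η.restrict Ω) :=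
    ENNReal.measurable_ofReal.comp_aemeasurable ((continuous_abs.measurable.comp
      ContinuousLinearMap.continuous_det.measurable).comp_aemeasurable (aemeasurable_fderivWithin η hΩ hψ'))
  have hc : AEMeasurable (fun X => jacDensity hlie X) (η.restrict Ω) := (measurable_jacDensity hlie).aemeasurable
  have hj : AEMeasurable (fun X => jacDensity hlie (ψ X) * ENNReal.ofReal |(ψ' X).det| / jacDensity hlie X)
      (η.restrict Ω) := (ha.mul hb).div hc
  refine hj.congr ((ae_restrict_mem hΩ).mono fun X hX => ?_)
  have hXs : ‖X‖ < chartRadius C := lt_of_lt_of_le (mem_ball_zero_iff.1 (hΩs hX)) hs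
  simp only [Function.comp_apply, h.logChart_expChart hXs]

omit [IsTopologicalGroup G] [μ.IsHaarMeasure] in
/-- The group-level Jacobian is finite `μ|_{Θ(Ω)}`-a.e. (indeed at every point of `Θ(Ω)`) when `det jac ≠ 0` on
`Ω ⊆ B(0,s)`. [cite: Helgason2000, Ch. I §1 Thm. 1.14 (12) p. 96] -/
theorem jacobian_lt_top_ae {s : ℝ} (hs : s ≤ chartRadius C)
    {Ω : Set C.lie} (hΩ : MeasurableSet Ω) (hΩs : Ω ⊆ Metric.ball (0 : C.lie) s)
    (hjac : ∀ X ∈ Ω, LinearMap.det (jac hlie X : C.lie →ₗ[ℝ] C.lie) ≠ 0)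
    (ψ : C.lie → C.lie) (ψ' : C.lie → C.lie →L[ℝ] C.lie) :
    ∀ᵐ g ∂μ.restrict (h.expChart '' Ω), jacDensity hlie (ψ (h.logChart g)) * ENNReal.ofReal |(ψ' (h.logChart g)).det| /
      jacDensity hlie (h.logChart g) < ∞ := by
  have hinjΩ : Set.InjOn h.expChart Ω := (h.injOn_expChart hs).mono hΩs
  refine (ae_restrict_mem (h.measurableSet_image_expChart hΩ hinjΩ)).mono ?_
  rintro _ ⟨X, hX, rfl⟩
  have hXs : ‖X‖ < chartRadius C := lt_of_lt_of_le (mem_ball_zero_iff.1 (hΩs hX)) hs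
  rw [h.logChart_expChart hXs]
  have hj0 : jacDensity hlie X ≠ 0 := by
    rw [jacDensity_def]; exact fun h0 => hjac X hX (abs_eq_zero.1 (ENNReal.ofReal_eq_zero.1 h0 |>.antisymm (abs_nonneg _)))
  refine ENNReal.div_lt_top ?_ hj0
  rw [jacDensity_def]
  exact ENNReal.mul_ne_top ENNReal.ofReal_ne_top ENNReal.ofReal_ne_top

/-- **THE MEASURE FORM OF THE GROUP-LEVEL JACOBIAN**: under the hypotheses of `lintegral_haar_image_eq_lintegral_mul_jacobian`,
**`μ|_{Ψ(Θ Ω)} = Ψ_*(J_Ψ · μ|_{Θ Ω})`** — the restriction of Haar measure to the image is the push-forward under `Ψ` of Haar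
measure on `Θ(Ω)` weighted by the Jacobian.  This is the shape a «fibred chart» hypothesis
`ν|_{…} = Φ_*(J · (μ ⊗ τ))` consumes coordinate-wise.
[cite: Helgason2000, Ch. I §1 Thm. 1.14 (13) p. 96] [cite: Balaban1987RG1, (2.10) p. 267] -/
theorem haar_restrict_image_eq_map_withDensity_jacobian {s : ℝ} (hs0 : 0 < s) (hs : s ≤ chartRadius C)
    {Ω : Set C.lie} (hΩ : MeasurableSet Ω) (hΩs : Ω ⊆ Metric.ball (0 : C.lie) s)
    (hjac : ∀ X ∈ Ω, LinearMap.det (jac hlie X : C.lie →ₗ[ℝ] C.lie) ≠ 0)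
    {ψ : C.lie → C.lie} {ψ' : C.lie → C.lie →L[ℝ] C.lie}
    (hψ' : ∀ X ∈ Ω, HasFDerivWithinAt ψ (ψ' X) Ω X) (hψ : Set.InjOn ψ Ω)
    (hψs : Set.MapsTo ψ Ω (Metric.ball (0 : C.lie) s)) {Ψ : G → G}
    (hΨ : ∀ X ∈ Ω, Ψ (h.expChart X) = h.expChart (ψ X)) :
    μ.restrict (Ψ '' (h.expChart '' Ω)) =
      Measure.map Ψ ((μ.restrict (h.expChart '' Ω)).withDensity fun g =>
        jacDensity hlie (ψ (h.logChart g)) * ENNReal.ofReal |(ψ' (h.logChart g)).det| / jacDensity hlie (h.logChart g)) := by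
  have hinjΩ : Set.InjOn h.expChart Ω := (h.injOn_expChart hs).mono hΩs
  have hψc : ContinuousOn ψ Ω := fun X hX => (hψ' X hX).continuousWithinAt
  have hΨm : AEMeasurable Ψ (μ.restrict (h.expChart '' Ω)) :=
    h.aemeasurable_restrict_image_of_semiconj hlie μ hs0 hs hΩ hinjΩ hψc hΨ
  have hJm := h.aemeasurable_jacobian hlie μ hs0 hs hΩ hΩs hψ'
  have hJtop := h.jacobian_lt_top_ae hlie μ hs hΩ hΩs hjac ψ ψ'
  have hΨm' : AEMeasurable Ψ ((μ.restrict (h.expChart '' Ω)).withDensity fun g =>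
      jacDensity hlie (ψ (h.logChart g)) * ENNReal.ofReal |(ψ' (h.logChart g)).det| / jacDensity hlie (h.logChart g)) :=
    hΨm.mono_ac (withDensity_absolutelyContinuous _ _)
  refine Measure.ext_of_lintegral _ fun f hf => ?_
  rw [lintegral_map' hf.aemeasurable hΨm', lintegral_withDensity_eq_lintegral_mul_non_measurable₀ _ hJm hJtop]
  show ∫⁻ g in Ψ '' (h.expChart '' Ω), f g ∂μ = _
  rw [h.lintegral_haar_image_eq_lintegral_mul_jacobian hlie μ hs0 hs hΩ hΩs hjac hψ' hψ hψs hΨ f]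
  exact lintegral_congr fun g => mul_comm _ _

variable {E : Type*} [NormedAddCommGroup E] [NormedSpace ℝ E]

/-- **THE BOCHNER FORM OF THE GROUP-LEVEL JACOBIAN**: under the hypotheses of `lintegral_haar_image_eq_lintegral_mul_jacobian`,
for every `F : G → E` a.e.-strongly measurable on `Ψ(Θ Ω)`:
`∫_{Ψ(Θ Ω)} F dμ = ∫_{Θ Ω} J_Ψ(g).toReal • F(Ψ g) dμ(g)`, `J_Ψ(g) = |det jac(ψ(Λg))|·|det ψ′(Λg)|/|det jac(Λg)|`.
[cite: Helgason2000, Ch. I §1 Thm. 1.14 (13) p. 96] [cite: Balaban1987RG1, (2.10) p. 267] -/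
theorem setIntegral_haar_image_eq_integral_jacobian_smul {s : ℝ} (hs0 : 0 < s) (hs : s ≤ chartRadius C)
    {Ω : Set C.lie} (hΩ : MeasurableSet Ω) (hΩs : Ω ⊆ Metric.ball (0 : C.lie) s)
    (hjac : ∀ X ∈ Ω, LinearMap.det (jac hlie X : C.lie →ₗ[ℝ] C.lie) ≠ 0)
    {ψ : C.lie → C.lie} {ψ' : C.lie → C.lie →L[ℝ] C.lie}
    (hψ' : ∀ X ∈ Ω, HasFDerivWithinAt ψ (ψ' X) Ω X) (hψ : Set.InjOn ψ Ω)
    (hψs : Set.MapsTo ψ Ω (Metric.ball (0 : C.lie) s)) {Ψ : G → G}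
    (hΨ : ∀ X ∈ Ω, Ψ (h.expChart X) = h.expChart (ψ X)) {F : G → E}
    (hF : AEStronglyMeasurable F (μ.restrict (Ψ '' (h.expChart '' Ω)))) :
    ∫ g in Ψ '' (h.expChart '' Ω), F g ∂μ =
      ∫ g in h.expChart '' Ω, (jacDensity hlie (ψ (h.logChart g)) * ENNReal.ofReal |(ψ' (h.logChart g)).det| /
        jacDensity hlie (h.logChart g)).toReal • F (Ψ g) ∂μ := by
  have hinjΩ : Set.InjOn h.expChart Ω := (h.injOn_expChart hs).mono hΩs
  have hψc : ContinuousOn ψ Ω := fun X hX => (hψ' X hX).continuousWithinAt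
  have hΨm : AEMeasurable Ψ (μ.restrict (h.expChart '' Ω)) :=
    h.aemeasurable_restrict_image_of_semiconj hlie μ hs0 hs hΩ hinjΩ hψc hΨ
  have hJm := h.aemeasurable_jacobian hlie μ hs0 hs hΩ hΩs hψ'
  have hJtop := h.jacobian_lt_top_ae hlie μ hs hΩ hΩs hjac ψ ψ'
  have hμ := h.haar_restrict_image_eq_map_withDensity_jacobian hlie μ hs0 hs hΩ hΩs hjac hψ' hψ hψs hΨ
  have hΨm' : AEMeasurable Ψ ((μ.restrict (h.expChart '' Ω)).withDensity fun g =>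
      jacDensity hlie (ψ (h.logChart g)) * ENNReal.ofReal |(ψ' (h.logChart g)).det| / jacDensity hlie (h.logChart g)) :=
    hΨm.mono_ac (withDensity_absolutelyContinuous _ _)
  rw [hμ] at hF ⊢
  rw [integral_map hΨm' hF, integral_withDensity_eq_integral_toReal_smul₀ hJm hJtop]

end ChartSide

end IsChartRep

end Literature.MathematicalPhysics.QuantumFieldTheory.Balaban1983to89.HaarExponentialChart
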